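import Summits.KontsevichZagierPeriods.KontsevichZagierPeriods.Theses.UnfoldedStokes
import Literature.NumberTheory.Transcendental.KZKernelConjectureForms
import Literature.NumberTheory.Transcendental.KZCalculusProofs
import Literature.NumberTheory.Transcendental.KZGroundingRelations
import Literature.NumberTheory.Transcendental.KZUnfoldedStokes
import Literature.NumberTheory.Transcendental.AyoubPeriodSeries
import Summits.KontsevichZagierPeriods.KontsevichZagierPeriods.Theorems.UnfoldedStokesStokesGenerationStubCubeCalibration
import Summits.KontsevichZagierPeriods.KontsevichZagierPeriods.Theorems.UnfoldedStokesStokesGenerationStubMergeCubes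
import Summits.KontsevichZagierPeriods.KontsevichZagierPeriods.Theorems.UnfoldedStokesStokesGenerationStubNashToGerm
import Summits.KontsevichZagierPeriods.KontsevichZagierPeriods.Theorems.UnfoldedStokesStokesGenerationStubGermToOan
import Summits.KontsevichZagierPeriods.KontsevichZagierPeriods.Theorems.UnfoldedStokesStokesGenerationStubSpanToReps

/-!
# `StokesGeneration` (stmt-KontsevichZagierPeriods-3586) — line `Sketch` (card cube-type-a-generation)

Crux proof SKELETON of the line lead (attempt 0). The crux is thesis part B of route
UnfoldedStokes, STOKES GENERATION: `ker eval ≤ relations ⊔ closure S`, `S` the unfolded-Stokes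
square relators. It is the Kontsevich–Zagier period conjecture in kernel form up to the square
relators (`stokesGeneration_of_kernel`, `kernel_of_stokesGeneration`; `stokesGeneration_of_summit`:
the SUMMIT implies the crux outright, by the tree's `kzKernelConjecture_iff_isRational`).

The line (card `Cruxes/StokesGeneration/Ideas/cube-type-a-generation.md`, Ayoub's cube
presentation [Ayoub 2014, Def. 9–10, Prop. 11; Ayoub 2015, Conj. 1.1, Rem. 1.2; Fresán 2024,
Conj. 3.5, Rem. 3.6–3.7]) reduces the crux to REGISTERED STUBS:

* `stub_cubeNashNormalForm` — (N₁) every difference of KZ-rational representations is, modulo the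
  moves, a `ℤ`-combination of closed-cube representations with integrands real-analytic and
  `ℚ`-semialgebraic near the closed cube (verbatim the support item `CubeNashNormalForm`,
  stmt-KontsevichZagierPeriods-3574 of route LiftingCriteria; resolution of singularities inside
  the rules; L);
* `stub_nashToGerm` — (N₂) a Nash cube representation is, modulo the moves, ONE cube representation
  whose integrand is on the closed cube the sum of a real power series at the corner `0` with
  polyradius of convergence `> 1` (uniform radius by compactness + `changeOrigin`, rational grid
  subdivision, affine rescaling of each sub-cube onto the unit cube, integrand additivity; M/L);
* `stub_mergeCubes` — a signed finite family of such germ cube representations is, modulo the moves,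
  ONE of them in a common dimension (slabs + iterated integrand additivity; M);
* `stub_germToOan` — (D) dictionary, analytic half: the germ is a real point of Ayoub's
  `𝒪_{ℚ̄-alg}(𝔻̄^∞)` (`AyoubRel.Oan`) and `AyoubRel.intC` is its integral over the cube (algebraicity
  of the series from semialgebraicity of its sum; termwise integration; M/L);
* `stub_typeAGeneration` — (T) the OPEN CORE, Ayoub's Conjecture 1.1 = Fresán's Conjecture 3.5 typed
  over `AyoubPeriodSeries.lean`: for `k` with algebraic image in `ℂ`, the kernel of `intC` on `Oan`
  is the `k`-span of the type-(a) elements `∂G/∂zᵢ − G|_{zᵢ=1} + G|_{zᵢ=0}`. GPC-STRENGTH: with the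
  other stubs it gives `KZKernelConjecture`, hence the summit; it is the honest residual of the line;
* `stub_spanToReps` — (R) dictionary, folding half: a real germ lying in that span is, on a cube of
  possibly larger dimension, a finite sum of REAL type-(a) integrands of `C¹` `ℚ`-semialgebraic
  functions (real parts coefficientwise; sums of `Oan` series are Nash near the cube; L);
* `stub_cubeCalibration` — (C) every real type-(a) cube integrand, for EVERY coordinate, is a
  relation of the four-move calculus (coordinate transposition + Newton–Leibniz + re-inflation of
  the two restriction terms + integrand additivity; = support item `AyoubRelACubeCalibration`,
  stmt-KontsevichZagierPeriods-0543 of route AyoubSpecialisation, without its two discharged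
  Tarski–Seidenberg antecedents; M);

composed in `StokesGeneration_of`: `eval x = 0` ⇒ `x ≡ [R] − [R']` rational
(`KZ.exists_integralRep_sub_holds`, `KZ.exists_isRational_equivalent_holds`) ⇒ (N₁, N₂, merge)
`x ≡ [□ᴺ, h]` one germ cube representation ⇒ (soundness) `∫_{□ᴺ} h = 0` ⇒ (D) `F ∈ Oan`, `intC F = 0`
⇒ (T) `F ∈ ⟨type (a)⟩_ℚ̄` ⇒ (R) `h ∘ pr = Σⱼ (∂_{iⱼ}Gⱼ − Gⱼ|₁ + Gⱼ|₀)` on `□ᴹ` ⇒ (lift + additivity +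
C) `x ∈ relations ≤ relations ⊔ closure S`. The sorry-free glue `liftCube` (raising a cube
representation to a higher-dimensional cube by slabs) is proved here.

References: Kontsevich–Zagier 2001 §1.2, §4.1; Ayoub 2014 (EMS Newsl. 91) §2.2; Ayoub 2015
(Ann. Math. 181) Conj. 1.1, Rem. 1.2; Fresán 2024 Conj. 3.5; Huber–Müller-Stach 2017 Ch. 13.
-/

noncomputable section

-- `Summit.KontsevichZagierPeriods.KontsevichZagierPeriods.…` is the tree's mandated layout (single-conjunct summit).
set_option linter.dupNamespace false

namespace Summit.KontsevichZagierPeriods.KontsevichZagierPeriods.StokesGenerationLine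

open MeasureTheory Set
open Literature.NumberTheory.Transcendental
open Literature.NumberTheory.Transcendental.KZ
open Summit.KontsevichZagierPeriods.KontsevichZagierPeriods.Theses.UnfoldedStokes
  (StokesGeneration UnfoldedStokesSquare)

/-! ## Calibration of the crux against the kernel conjecture and the summit (sorry-free) -/

/-- **Kernel conjecture ⇒ crux.** `ker eval ≤ relations` trivially gives
`ker eval ≤ relations ⊔ closure S`. [cite: KontsevichZagier2001, §1.2 Conjecture 1] -/
theorem stokesGeneration_of_kernel (h : KZKernelConjecture) : StokesGeneration := fun x hx =>
  AddSubgroup.mem_sup_left (h x hx)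

/-- **Summit ⇒ crux.** The summit statement (two KZ-rational representations with the same value
are equivalent) is equivalent to the kernel conjecture (`kzKernelConjecture_iff_isRational`, proved
in the tree), hence implies the crux: `StokesGeneration` is no stronger than the summit.
[cite: KontsevichZagier2001, §1.2 Conjecture 1] -/
theorem stokesGeneration_of_summit (h : _root_.KontsevichZagierPeriods) : StokesGeneration :=
  stokesGeneration_of_kernel (kzKernelConjecture_iff_isRational.mpr (KontsevichZagierPeriods_iff.mp h))

/-- **Crux ∧ part A (square) ⇒ kernel conjecture.** Every square relator is a relation by
`UnfoldedStokesSquare` (crux stmt-3520), so `relations ⊔ closure S = relations`.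
[cite: KontsevichZagier2001, §1.2 Conjecture 1] -/
theorem kernel_of_stokesGeneration (hU : UnfoldedStokesSquare) (h : StokesGeneration) :
    KZKernelConjecture := by
  intro x hx
  have hmem := h x hx
  have hsub : ∀ (A B : AddSubgroup FormalRep), B ≤ A → ∀ y, y ∈ A ⊔ B → y ∈ A :=
    fun A B hle y hy => (sup_le le_rfl hle) hy
  refine hsub _ _ ((AddSubgroup.closure_le _).mpr ?_) _ hmem
  rintro d ⟨U, a, b, c, e, rB, rR, rT, rL, rW, rD, hUo, hUI, hUs, ha, hb, hc, he, hcl, sa, sb, sc,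
    se, sa0, sa1, sb1, sc1, se0, hBd, hBi, hRd, hRi, hTd, hTi, hLd, hLi, hWd, hWi, hDd, hDi, rfl⟩
  exact hU U a b c e hUo hUI hUs ha hb hc he hcl sa sb sc se sa0 sa1 sb1 sc1 se0 rB rR rT rL rW rD
    hBd hBi hRd hRi hTd hTi hLd hLi hWd hWi hDd hDi

/-- **Summit ⇒ kernel conjecture** (for the record: with `kernel_of_stokesGeneration` and
`stokesGeneration_of_summit`, the crux is sandwiched between the summit and
`UnfoldedStokesSquare → summit`). [cite: KontsevichZagier2001, §1.2 Conjecture 1] -/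
theorem kernel_of_summit (h : _root_.KontsevichZagierPeriods) : KZKernelConjecture :=
  kzKernelConjecture_iff_isRational.mpr (KontsevichZagierPeriods_iff.mp h)

/-! ## Registered stubs -/

/-- STUB (N₁) `CubeNashNormalForm` — verbatim the body of
`Summit.KontsevichZagierPeriods.KontsevichZagierPeriods.Theses.LiftingCriteria.CubeNashNormalForm`
(support item stmt-KontsevichZagierPeriods-3574): every difference of KZ-rational representations
is KZ-equivalent to a `ℤ`-combination of closed-cube representations `∫_{[0,1]^{nᵢ}} gᵢ` with `gᵢ`
`ℚ`-semialgebraic and real-analytic on a neighbourhood of the closed cube (semialgebraic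
triangulation + resolution + ramified substitutions, realised by additivity and change-of-variables
moves). [cite: KontsevichZagier2001, §1.2] -/
theorem stub_cubeNashNormalForm :
    ∀ (k k' : ℕ) (r : IntegralRep k) (r' : IntegralRep k'), r.IsRational → r'.IsRational →
      ∃ (S : ℕ) (n : Fin S → ℕ) (g : (i : Fin S) → (Fin (n i) → ℝ) → ℝ)
        (U : (i : Fin S) → Set (Fin (n i) → ℝ)) (ε : Fin S → ℤ)
        (s : (i : Fin S) → IntegralRep (n i)),
        (∀ i, IsOpen (U i) ∧ Set.pi Set.univ (fun _ : Fin (n i) => Set.Icc (0:ℝ) 1) ⊆ (U i) ∧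
          IsSemialgebraicFunOn ℚ (U i) (g i) ∧ AnalyticOnNhd ℝ (g i) (U i)) ∧
        (∀ i, (s i).domain = Set.pi Set.univ (fun _ : Fin (n i) => Set.Icc (0:ℝ) 1) ∧
          ∀ z ∈ Set.pi Set.univ (fun _ : Fin (n i) => Set.Icc (0:ℝ) 1), (s i).integrand z = g i z) ∧
        of r - of r' - ∑ i, ε i • of (s i) ∈ relations := by
  sorry

/-! LANDED stubs (imported above, same namespace, exact registered signatures):
`stub_nashToGerm` (p101780, `Theorems/UnfoldedStokesStokesGenerationStubNashToGerm.lean`),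
`stub_mergeCubes` (p99241, `Theorems/UnfoldedStokesStokesGenerationStubMergeCubes.lean`),
`stub_germToOan` (p109733, `Theorems/UnfoldedStokesStokesGenerationStubGermToOan.lean` + `…Aux{Identity,Eval,Series}`),
`stub_spanToReps` (p113092, `Theorems/UnfoldedStokesStokesGenerationStubSpanToReps.lean` + `…Aux{C1,Semialg,Coeff,Series,Alg}`),
`stub_cubeCalibration` (p97569, `Theorems/UnfoldedStokesStokesGenerationStubCubeCalibration.lean`).
OPEN below: `stub_cubeNashNormalForm` (N₁, = LiftingCriteria stmt-3574, resolution of singularities inside the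
rules) and `stub_typeAGeneration` (T, Ayoub's Conjecture 1.1 — the residual). -/

/-- STUB (T) — THE OPEN CORE of the line: **Ayoub's Conjecture 1.1** (Ann. of Math. 181 (2015),
Conj. 1.1 with Rem. 1.2; = Fresán 2024, Conj. 3.5), typed over `AyoubPeriodSeries.lean`: for a
field `k` embedded in `ℂ` with algebraic image, every `F ∈ 𝒪_{k-alg}(𝔻̄^∞)` with `∫_{[0,1]^∞} F = 0`
is a `k`-linear combination of type-(a) elements `∂G/∂zᵢ − G|_{zᵢ=1} + G|_{zᵢ=0}`,
`G ∈ 𝒪_{k-alg}(𝔻̄^∞)`. OPEN (GPC-strength: together with the other stubs of this file it yields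
`KZKernelConjecture`, hence the summit; the barriers `kzConjecture_implies_*` apply to it). It is
quantified over ALL numbers of variables (one variable does not suffice:
`Literature.Barriers.KontsevichZagierPeriods.KZ.kernelElt_not_stokes_one_variable`).
[cite: Ayoub2015, Conj. 1.1] -/
theorem stub_typeAGeneration :
    ∀ (k : Type) [Field k] [CharZero k] (σ : k →+* ℂ), (∀ c : k, IsAlgebraic ℚ (σ c)) →
      ∀ F ∈ AyoubRel.Oan σ, AyoubRel.intC F = 0 →
        F ∈ AyoubRel.kSpan σ
          {x : AyoubRel.CSeries | ∃ G ∈ AyoubRel.Oan σ, ∃ i : ℕ, x = AyoubRel.relAC i G} := by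
  sorry

/-! ## Sorry-free glue -/

/-- The closed unit cube written as `Set.pi univ (fun _ => Icc 0 1)` is measurable. [folklore] -/
theorem measurableSet_cubePi (N : ℕ) :
    MeasurableSet (Set.pi Set.univ (fun _ : Fin N => Set.Icc (0:ℝ) 1)) :=
  MeasurableSet.univ_pi fun _ => measurableSet_Icc

/-- Rewriting the domain of a representation along a set equality (the representation with the
rewritten domain is the same structure). [folklore] -/
theorem exists_domain_eq {N : ℕ} (r : IntegralRep N) {s : Set (Fin N → ℝ)} (hs : r.domain = s) :
    ∃ r' : IntegralRep N, r'.domain = s ∧ r'.integrand = r.integrand ∧ of r - of r' ∈ relations := by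
  subst hs
  exact ⟨r, rfl, rfl, by simp [relations.zero_mem]⟩

/-- **Lifting a cube representation by one slab**: `[□ᴺ, f] ∼ [□ᴺ⁺¹, f ∘ init]` (one Newton–Leibniz
move with primitive `t · f`, `KZ.IntegralRep.slab`). [cite: KontsevichZagier2001, §1.2 rule (3)] -/
theorem liftCube_succ (N : ℕ) (t : IntegralRep N)
    (ht : t.domain = Set.pi Set.univ (fun _ : Fin N => Set.Icc (0:ℝ) 1)) :
    ∃ t' : IntegralRep (N + 1), t'.domain = Set.pi Set.univ (fun _ : Fin (N + 1) => Set.Icc (0:ℝ) 1) ∧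
      (∀ x ∈ Set.pi Set.univ (fun _ : Fin (N + 1) => Set.Icc (0:ℝ) 1),
        t'.integrand x = t.integrand (Fin.init x)) ∧
      of t - of t' ∈ relations := by
  have hdom : (t.slab 0).domain = Set.pi Set.univ (fun _ : Fin (N + 1) => Set.Icc (0:ℝ) 1) := by
    ext z
    simp only [IntegralRep.domain_slab, IntegralRep.slabDomain, ht, Nat.cast_zero, zero_add,
      mem_setOf_eq, mem_pi, mem_univ, true_implies, mem_Icc]
    constructor
    · rintro ⟨h1, h2, h3⟩ i
      refine Fin.lastCases ?_ (fun j => ?_) i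
      · exact ⟨h2, h3⟩
      · simpa [Fin.init] using h1 j
    · intro hz
      exact ⟨fun j => by simpa [Fin.init] using hz (Fin.castSucc j), (hz (Fin.last N)).1,
        (hz (Fin.last N)).2⟩
  obtain ⟨t', ht'd, ht'i, hrel⟩ := exists_domain_eq (t.slab 0) hdom
  refine ⟨t', ht'd, fun x _ => by rw [ht'i]; rfl, ?_⟩
  have h1 : of (t.slab 0) - of t ∈ relations :=
    newtonLeibnizRel_subset_relations (t.of_slab_sub_of_mem_newtonLeibnizRel 0)
  have : of t - of t' = -(of (t.slab 0) - of t) + (of (t.slab 0) - of t') := by abel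
  rw [this]
  exact relations.add_mem (relations.neg_mem h1) hrel

/-- **Lifting a cube representation to any higher dimension**: `[□ᴺ, f] ∼ [□ᴹ, f ∘ pr]` for
`N ≤ M`, `pr` the projection to the first `N` coordinates (iterate `liftCube_succ`).
[cite: KontsevichZagier2001, §1.2 rule (3)] -/
theorem liftCube (N M : ℕ) (hNM : N ≤ M) (t : IntegralRep N)
    (ht : t.domain = Set.pi Set.univ (fun _ : Fin N => Set.Icc (0:ℝ) 1)) :
    ∃ t' : IntegralRep M, t'.domain = Set.pi Set.univ (fun _ : Fin M => Set.Icc (0:ℝ) 1) ∧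
      (∀ x ∈ Set.pi Set.univ (fun _ : Fin M => Set.Icc (0:ℝ) 1),
        t'.integrand x = t.integrand (fun l => x (Fin.castLE hNM l))) ∧
      of t - of t' ∈ relations := by
  obtain ⟨d, rfl⟩ := Nat.exists_eq_add_of_le hNM
  induction d with
  | zero =>
    refine ⟨t, ht, fun x _ => ?_, by simp [relations.zero_mem]⟩
    rfl
  | succ d ih =>
    obtain ⟨t₁, ht₁d, ht₁i, ht₁r⟩ := ih (Nat.le_add_right N d)
    obtain ⟨t₂, ht₂d, ht₂i, ht₂r⟩ := liftCube_succ (N + d) t₁ ht₁d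
    refine ⟨t₂, ht₂d, fun x hx => ?_, ?_⟩
    · rw [ht₂i x hx, ht₁i (Fin.init x) (fun j _ => hx (Fin.castSucc j) (mem_univ _))]
      rfl
    · have : of t - of t₂ = (of t - of t₁) + (of t₁ - of t₂) := by abel
      rw [this]
      exact relations.add_mem ht₁r ht₂r

/-- The embedding `ℚ̄ = algebraicClosure ℚ ℂ ↪ ℂ` has algebraic image. [folklore] -/
theorem isAlgebraic_algebraMap_algebraicClosure (c : algebraicClosure ℚ ℂ) :
    IsAlgebraic ℚ (algebraMap (algebraicClosure ℚ ℂ) ℂ c) := by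
  have hc : (c : ℂ) ∈ algebraicClosure ℚ ℂ := c.2
  rw [mem_algebraicClosure_iff] at hc
  exact hc

/-! ## The composition -/

/-- **The crux from the stubs.** `eval x = 0` ⇒ `x ≡ [R] − [R']` with `R, R'` KZ-rational
(`exists_integralRep_sub_holds`, `exists_isRational_equivalent_holds`) ⇒ `x ≡ Σ εᵢ [sᵢ]` Nash cubes
(N₁) ⇒ germ cubes (N₂) ⇒ one germ cube `[□ᴺ, h]` (merge) ⇒ `∫_{□ᴺ} h = 0` (soundness
`relations_le_ker_eval_holds`) ⇒ `F ∈ Oan`, `intC F = 0` (D) ⇒ `F ∈ ⟨type (a)⟩_ℚ̄` (T) ⇒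
`[□ᴹ, h ∘ pr] = Σⱼ [□ᴹ, ∂Gⱼ − Gⱼ|₁ + Gⱼ|₀]` (R, `liftCube`, integrand additivity) ⇒ each term is a
relation (C) ⇒ `x ∈ relations ≤ relations ⊔ closure S`.
[cite: KontsevichZagier2001, §1.2 Conjecture 1] -/
theorem StokesGeneration_of : StokesGeneration := by
  classical
  intro x hx
  refine AddSubgroup.mem_sup_left ?_
  -- (1) two rational representations
  obtain ⟨n, m, r, r', hrel⟩ := exists_integralRep_sub_holds x
  obtain ⟨n₁, R, hR, hrR⟩ := exists_isRational_equivalent_holds r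
  obtain ⟨m₁, R', hR', hrR'⟩ := exists_isRational_equivalent_holds r'
  -- (2) Nash cube normal form
  obtain ⟨S, nS, g, U, ε, s, hNash, hs, hNF⟩ := stub_cubeNashNormalForm n₁ m₁ R R' hR hR'
  -- (3) germ cubes
  have hgerm := fun i : Fin S =>
    stub_nashToGerm (nS i) (g i) (U i) (s i) (hNash i).1 (hNash i).2.1 (hNash i).2.2.1
      (hNash i).2.2.2 (hs i).1 (hs i).2
  choose h V c Rr t hV hVsub hsa hR1 hsum hHas htd hti hst using hgerm
  -- (4) merge
  obtain ⟨N, h', V', c', R₁, t', hV', hV'sub, hsa', hR1', hsum', hHas', ht'd, ht'i, hmerge⟩ :=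
    stub_mergeCubes S nS ε h V c Rr t
      (fun i => ⟨hV i, hVsub i, hsa i, hR1 i, hsum i, hHas i, htd i, hti i⟩)
  -- (5) `x ≡ [t']`
  have hxt' : x - of t' ∈ relations := by
    have e3 : ∑ i, ε i • (of (s i) - of (t i)) ∈ relations :=
      AddSubgroup.sum_mem _ fun i _ => AddSubgroup.zsmul_mem _ (hst i) _
    have : x - of t' = (x - (of r - of r')) + (of r - of R) - (of r' - of R') +
        (of R - of R' - ∑ i, ε i • of (s i)) + ∑ i, ε i • (of (s i) - of (t i)) +
        (∑ i, ε i • of (t i) - of t') := by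
      simp only [smul_sub, Finset.sum_sub_distrib]; abel
    rw [this]
    exact relations.add_mem (relations.add_mem (relations.add_mem (relations.sub_mem
      (relations.add_mem hrel hrR) hrR') hNF) e3) hmerge
  -- (6) the value vanishes
  have hval : (∫ z in Set.pi Set.univ (fun _ : Fin N => Set.Icc (0:ℝ) 1), h' z) = 0 := by
    have h0 : eval (of t') = 0 := by
      have := relations_le_ker_eval_holds hxt'
      rwa [AddMonoidHom.mem_ker, map_sub, hx, zero_sub, neg_eq_zero] at this
    rw [eval_of, IntegralRep.value, ht'd, setIntegral_congr_fun (measurableSet_cubePi N)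
      (fun z hz => ht'i z hz)] at h0
    exact h0
  -- (7) dictionary: the germ as an element of `Oan`, with `intC = 0`
  obtain ⟨F, hFc, hFz, hFO, hFint⟩ :=
    stub_germToOan N h' V' c' R₁ hV' hV'sub hsa' hR1' hsum' hHas'
  have hF0 : AyoubRel.intC F = 0 := by rw [hFint, hval]; simp
  -- (8) the open core: type-(a) generation
  have hspan := stub_typeAGeneration (algebraicClosure ℚ ℂ) (algebraMap (algebraicClosure ℚ ℂ) ℂ)
    isAlgebraic_algebraMap_algebraicClosure F hFO hF0
  -- (9) fold back to real `C¹` semialgebraic type-(a) integrands on a bigger cube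
  obtain ⟨M, hNM, J, idx, G, W, q, hG, hq, hdec⟩ :=
    stub_spanToReps N h' c' R₁ F hR1' hsum' hHas' hFc hFz hspan
  obtain ⟨t'', ht''d, ht''i, hlift⟩ := liftCube N M hNM t' ht'd
  -- (10) `[t''] ≡ Σⱼ [qⱼ]`, each `[qⱼ] ∈ relations`
  have hsumq : of t'' - ∑ j, of (q j) ∈ relations := by
    refine of_sub_sum_integrand_mem_relations Finset.univ q t''
      (fun j _ => by rw [(hq j).1, ht''d]) ?_
    intro z hz
    rw [ht''d] at hz
    show t''.integrand z = ∑ j ∈ Finset.univ, (q j).integrand z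
    rw [ht''i z hz, ht'i _ (fun l _ => hz (Fin.castLE hNM l) (mem_univ _)), hdec z hz]
  have hqrel : ∑ j, of (q j) ∈ relations :=
    AddSubgroup.sum_mem _ fun j _ =>
      stub_cubeCalibration M (idx j) (G j) (W j) (hG j).1 (hG j).2.1 (hG j).2.2.1 (hG j).2.2.2
        (q j) (hq j).1 (hq j).2
  -- (11) assemble
  have : x = (x - of t') + (of t' - of t'') + (of t'' - ∑ j, of (q j)) + ∑ j, of (q j) := by abel
  rw [this]
  exact relations.add_mem (relations.add_mem (relations.add_mem hxt' hlift) hsumq) hqrel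

end Summit.KontsevichZagierPeriods.KontsevichZagierPeriods.StokesGenerationLine
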